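import Mathlib
import Summits.Ventures.PercRepro2.Defs
import Summits.Ventures.PercRepro2.Graph
import Summits.Ventures.PercRepro2.OneColourSwitch
import Summits.Ventures.PercRepro2.RegionHubSign
import Summits.Ventures.PercRepro2.SideSwitch
import Summits.Ventures.PercRepro2.SideSwitchFibre
import Summits.Ventures.PercRepro2.SideSwitchClosed
import Summits.Ventures.PercRepro2.SideSwitchComps
import Summits.Ventures.PercRepro2.SideSwitchCompsFibre
import Summits.Ventures.PercRepro2.M9NoPocketDefs
import Summits.Ventures.PercRepro2.M9NoPocketWorld
import Summits.Ventures.PercRepro2.M9NoPocketWorldD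
import Summits.Ventures.PercRepro2.M9NoPocketMono
import Summits.Ventures.PercRepro2.M9NoPocketCompl
import Summits.Ventures.PercRepro2.M9DAvoid
import Summits.Ventures.PercRepro2.M9RegionSplit
import Summits.Ventures.PercRepro2.M9PocketCubeDefs
import Summits.Ventures.PercRepro2.M9PocketCubeMono

/-!
# The block-group cube WITH a pocket — the hub edges along the cube (blind cell PercRepro2,
p3 g23, 2026-08-28; `proofs/P3-HARRIS.md` §3)

Basic facts about the assignments of a pocket representative (`Sep` in `G − d`, the value of a
link `d`–block, every vertex other than `d, r, s` is a pocket vertex or a block vertex) and the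
monotonicity of the hub predicates of `M9RegionSplit` along the cube: `hubY` increases
(`hubY_assignX_mono`: a `Y`-hub edge at `x` is a `Y` pocket edge, hence in `x.2 ⊆ x'.2`, or a
link to a `B`-side block, which stays `B`-side, and its `G − d` connection to `p` or `q` survives
by `conn_endsD_assignX_mono`) and `hubW` decreases (`hubW_assignX_anti`, the mirror).  Own work;
std axioms.
-/

namespace Summit.Ventures.PercRepro2

namespace NoPocket

open Finset Classical RegionHub OneColourSwitch SideSwitch

variable {V : Type*} {E : Type*}

section Basic

variable [Fintype V] [DecidableEq V] [Fintype E] [DecidableEq E]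

variable {ends : E → Sym2 V}

/-- An assignment of a representative is `Sep` in `G − d`. -/
lemma sep2_endsD_assignX' {p q r s d : V} (hr : d ≠ r) (hs : d ≠ s) {ρ : Config E}
    (hρ : ρ ∈ RepD ends p q r s d) {x : Finset (Finset V) × Finset E}
    (hT : x.1 ⊆ blocks ends d r s ρ) (hF : x.2 ⊆ freeE ends d r s ρ) :
    sep2 (endsD ends d) p q r s (assignX ends x ρ) := by
  obtain ⟨hsep, _, _⟩ := mem_RepD.1 hρ
  have h := sep2_assignC (ends := endsD ends d) hsep hT
  rw [sep2_iff] at h ⊢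
  rw [K2_endsD_assignX_eq' hr hs hρ hT hF, M2_endsD_assignX_eq' hr hs hρ hT hF]
  exact h

/-- An edge from `d` to a block vertex is not a pocket edge. -/
lemma not_mem_Pk_of_block {p q r s d : V} {ρ : Config E} (hρ : ρ ∈ RepD ends p q r s d)
    {C : Finset V} (hC : C ∈ blocks ends d r s ρ) {y : V} (hy : y ∈ C) {e : E}
    (he : ends e = s(d, y)) : e ∉ Pk ends d r s ρ := by
  intro hP
  have hyA : y ∈ A0 (endsD ends d) r s ρ := subset_A0_of_mem_comps (ends := endsD ends d) hC hy
  have hyK : y ∈ K2 (endsD ends d) r s ρ :=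
    A0_subset_K2_of_mem_Rep (mem_Rep_endsD_of_mem_RepD hρ) hyA
  exact not_mem_within_Oprime_of_mem_world (by rw [he, Sym2.eq_swap]) (Or.inl hyK) (mem_Pk.1 hP)

/-- The value of a link `d`–block in an assignment: flipped iff the block is switched. -/
lemma assignX_block_edge' {p q r s d : V} {ρ : Config E} (hρ : ρ ∈ RepD ends p q r s d)
    {x : Finset (Finset V) × Finset E} (hT : x.1 ⊆ blocks ends d r s ρ)
    (hF : x.2 ⊆ freeE ends d r s ρ) (hr : d ≠ r) (hs : d ≠ s) {C : Finset V}
    (hC : C ∈ blocks ends d r s ρ) {y : V} (hy : y ∈ C) {e : E} (he : ends e = s(d, y)) :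
    assignX ends x ρ e = (if C ∈ x.1 then !ρ e else ρ e) := by
  have hnotT : e ∉ x.2 := fun h => by
    rcases mem_freeE.1 (hF h) with h' | h'
    · exact not_mem_Tset_of_block hρ hC hy hr hs he h'
    · exact not_mem_Pk_of_block hρ hC hy he h'
  have hval : flipF x.2 ρ e = ρ e := flipF_of_notMem hnotT
  by_cases hCx : C ∈ x.1
  · rw [if_pos hCx, assignX, flipTouch_of_mem ends ⟨y, Finset.mem_coe.2 (mem_unionT.2 ⟨C, hCx, hy⟩), d,
      by rw [he, Sym2.eq_swap]⟩, hval]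
  · rw [if_neg hCx, assignX, flipTouch_of_notMem ends, hval]
    rintro ⟨z, hz, w, hzw⟩
    rw [he, Sym2.eq_iff] at hzw
    rcases hzw with ⟨h1, _⟩ | ⟨_, h2⟩
    · obtain ⟨C', hC', hzC'⟩ := mem_unionT.1 (Finset.mem_coe.1 hz)
      exact (block_vertex_ne hρ (hT hC') hzC' hr hs).2.2 h1.symm
    · rw [← h2] at hz
      exact hCx (block_mem_of_mem_unionT hρ hT hC hy (Finset.mem_coe.1 hz))

omit [Fintype E] [DecidableEq E] in
/-- Every vertex other than `r, s` is a pocket vertex (of `G − d`, `d` included) or a block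
vertex. -/
lemma mem_Oprime_or_block {d r s : V} (ρ : Config E) {u : V} (hur : u ≠ r) (hus : u ≠ s) :
    u ∈ Oprime ends d r s ρ ∨ ∃ C ∈ blocks ends d r s ρ, u ∈ C := by
  by_cases hu : u ∈ K2 (endsD ends d) r s ρ ∪ M2 (endsD ends d) r s ρ
  · right
    have hA : u ∈ A0 (endsD ends d) r s ρ := mem_A0.2 ⟨hu, hur, hus⟩
    rw [← unionT_comps] at hA
    exact mem_unionT.1 hA
  · left
    rw [Set.mem_union, not_or] at hu
    exact mem_Oprime.2 hu

omit [Fintype V] [DecidableEq V] [DecidableEq E] in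
/-- An edge from `d` to a pocket vertex is a pocket edge. -/
lemma mem_Pk_of_mem_Oprime {d r s : V} (hr : d ≠ r) (hs : d ≠ s) {ρ : Config E} {u : V}
    (hu : u ∈ Oprime ends d r s ρ) {e : E} (he : ends e = s(d, u)) : e ∈ Pk ends d r s ρ :=
  mem_Pk.2 ⟨d, d_mem_Oprime hr hs ρ, u, hu, he⟩

end Basic

section Hub

variable [Fintype V] [DecidableEq V] [Fintype E] [DecidableEq E]

variable {ends : E → Sym2 V}

/-- **(M2′) `hubY` increases along the cube.** -/
theorem hubY_assignX_mono {p q r s d : V} (hr : d ≠ r) (hs : d ≠ s) (hpd : p ≠ d) (hqd : q ≠ d)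
    {ρ : Config E} (hρ : ρ ∈ RepP ends p q r s d) {x x' : Finset (Finset V) × Finset E}
    (hxx' : x ≤ x') (hx : x ∈ cubeP ends d r s ρ) (hx' : x' ∈ cubeP ends d r s ρ)
    (h : hubY ends d p q (assignX ends x ρ)) : hubY ends d p q (assignX ends x' ρ) := by
  obtain ⟨hρD, _⟩ := mem_RepP.1 hρ
  obtain ⟨hT, hF⟩ := mem_cubeP.1 hx
  obtain ⟨hT', hF'⟩ := mem_cubeP.1 hx'
  obtain ⟨e, u, hends, he, hc⟩ := h
  have hsep := sep2_endsD_assignX' hr hs hρD hT hF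
  -- the target `t ∈ {p, q}` with `Conn (G − d) u t`
  obtain ⟨t, htd, htK, hct⟩ : ∃ t, t ≠ d ∧ t ∉ K2 (endsD ends d) r s (assignX ends x ρ) ∧
      Conn (endsD ends d) (assignX ends x ρ) u t := by
    rcases hc with hc | hc
    · exact ⟨p, hpd, (not_mem_K2_of_sep2 hsep).1, hc⟩
    · exact ⟨q, hqd, (not_mem_K2_of_sep2 hsep).2, hc⟩
  have hud : u ≠ d := by
    rintro rfl
    exact htd (eq_of_conn_endsD_d hct)
  have huK : u ∉ K2 (endsD ends d) r s (assignX ends x ρ) :=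
    not_mem_K2_endsD_of_conn htK (conn_symm hct)
  have hct' : Conn (endsD ends d) (assignX ends x' ρ) u t :=
    conn_endsD_assignX_mono hr hs hρ hxx' hx hx' huK hct
  have hur : u ≠ r := by rintro rfl; exact huK (r_mem_K2 _ _ _)
  have hus : u ≠ s := by rintro rfl; exact huK (s_mem_K2 _ _ _)
  refine ⟨e, u, hends, ?_, ?_⟩
  · rcases mem_Oprime_or_block (ends := ends) (d := d) ρ hur hus with hu | ⟨C, hC, huC⟩
    · have hP : e ∈ Pk ends d r s ρ := mem_Pk_of_mem_Oprime hr hs hu hends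
      have hex : e ∈ x.2 := by
        by_contra hx2
        rw [assignX_Pk_eq_false_of_notMem hρ hT hP hx2] at he
        exact Bool.noConfusion he
      exact assignX_Pk_eq_true_of_mem hρ hT' hP (hxx'.2 hex)
    · have hCx : C ∈ x.1 := by
        by_contra hCx
        apply huK
        rw [K2_endsD_assignX' hr hs hρD hT hF]
        exact ⟨mem_K2_endsD_of_block hρD hC huC, fun h' =>
          hCx (block_mem_of_mem_unionT hρD hT hC huC (Finset.mem_coe.1 h'))⟩
      rw [assignX_block_edge' hρD hT' hF' hr hs hC huC hends, if_pos (hxx'.1 hCx)]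
      rw [assignX_block_edge' hρD hT hF hr hs hC huC hends, if_pos hCx] at he
      exact he
  · rcases hc with hc | hc
    · exact Or.inl (conn_endsD_assignX_mono hr hs hρ hxx' hx hx' huK hc)
    · exact Or.inr (conn_endsD_assignX_mono hr hs hρ hxx' hx hx' huK hc)

/-- **(M2″) `hubW` decreases along the cube.** -/
theorem hubW_assignX_anti {p q r s d : V} (hr : d ≠ r) (hs : d ≠ s) (hpd : p ≠ d) (hqd : q ≠ d)
    {ρ : Config E} (hρ : ρ ∈ RepP ends p q r s d) {x x' : Finset (Finset V) × Finset E}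
    (hxx' : x ≤ x') (hx : x ∈ cubeP ends d r s ρ) (hx' : x' ∈ cubeP ends d r s ρ)
    (h : hubW ends d p q (assignX ends x' ρ)) : hubW ends d p q (assignX ends x ρ) := by
  obtain ⟨hρD, _⟩ := mem_RepP.1 hρ
  obtain ⟨hT, hF⟩ := mem_cubeP.1 hx
  obtain ⟨hT', hF'⟩ := mem_cubeP.1 hx'
  obtain ⟨e, u, hends, he, hc⟩ := h
  have hsep := sep2_endsD_assignX' hr hs hρD hT' hF'
  obtain ⟨t, htd, htM, hct⟩ : ∃ t, t ≠ d ∧ t ∉ M2 (endsD ends d) r s (assignX ends x' ρ) ∧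
      Conn (endsD ends d) (OneColourSwitch.compl (assignX ends x' ρ)) u t := by
    rcases hc with hc | hc
    · exact ⟨p, hpd, (not_mem_M2_of_sep2 hsep).1, hc⟩
    · exact ⟨q, hqd, (not_mem_M2_of_sep2 hsep).2, hc⟩
  have hud : u ≠ d := by
    rintro rfl
    exact htd (eq_of_conn_endsD_d hct)
  have huM : u ∉ M2 (endsD ends d) r s (assignX ends x' ρ) := by
    have htK : t ∉ K2 (endsD ends d) r s (OneColourSwitch.compl (assignX ends x' ρ)) := by
      rwa [K2_compl]
    have := not_mem_K2_endsD_of_conn htK (conn_symm hct)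
    rwa [K2_compl] at this
  have hur : u ≠ r := by rintro rfl; exact huM (r_mem_M2 _ _ _)
  have hus : u ≠ s := by rintro rfl; exact huM (s_mem_M2 _ _ _)
  refine ⟨e, u, hends, ?_, ?_⟩
  · simp only [OneColourSwitch.compl, Bool.not_eq_true'] at he ⊢
    rcases mem_Oprime_or_block (ends := ends) (d := d) ρ hur hus with hu | ⟨C, hC, huC⟩
    · have hP : e ∈ Pk ends d r s ρ := mem_Pk_of_mem_Oprime hr hs hu hends
      have hex : e ∉ x'.2 := by
        intro hx2
        rw [assignX_Pk_eq_true_of_mem hρ hT' hP hx2] at he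
        exact Bool.noConfusion he
      exact assignX_Pk_eq_false_of_notMem hρ hT hP (fun h' => hex (hxx'.2 h'))
    · have hCx : C ∉ x'.1 := by
        intro hCx
        apply huM
        rw [M2_endsD_assignX' hr hs hρD hT' hF']
        exact Or.inr (Finset.mem_coe.2 (mem_unionT.2 ⟨C, hCx, huC⟩))
      rw [assignX_block_edge' hρD hT hF hr hs hC huC hends, if_neg (fun h' => hCx (hxx'.1 h'))]
      rw [assignX_block_edge' hρD hT' hF' hr hs hC huC hends, if_neg hCx] at he
      exact he
  · rcases hc with hc | hc
    · exact Or.inl (conn_endsD_compl_assignX_anti hr hs hρ hxx' hx hx' huM hc)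
    · exact Or.inr (conn_endsD_compl_assignX_anti hr hs hρ hxx' hx hx' huM hc)

end Hub

end NoPocket

end Summit.Ventures.PercRepro2
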